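import Literature.MathematicalPhysics.QuantumLattice.HubbardFermiCurvature
import Mathlib.Analysis.Calculus.MeanValue
import HarnessLib

/-!
# Sector geometry of the Hubbard Fermi curve: Lemmas 7.2 and 7.3 of
Benfatto–Giuliani–Mastropietro 2003 (radial and normal/tangential deviations)

Topic `Literature/MathematicalPhysics/QuantumLattice`; continues `HubbardFermiRadius*.lean` and
`HubbardFermiCurvature.lean` (the polar Fermi radius `u = fermiRadius μ` of
`ε(k) = -2(cos k₁ + cos k₂)`, `-4 < μ < -2 - √2`: real-analytic, `u' = fermiRadiusDeriv`,
`u'' = fermiRadiusDeriv2`, curvature and transversality bounds).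

BGM 2006 decompose each momentum shell into angular sectors `S_{h,ω}` of width `π γ^{h/2}`
around the angles `θ_{h,ω}` (§2.5, (2.45)) and write every momentum of a sector in the moving frame
of the Fermi curve at the sector's centre, `k = p_F(θ_{h,ω}) + k'₁ n(θ_{h,ω}) + k'₂ τ(θ_{h,ω})` with
`τ = (u'e_r + u e_t)/√(u'² + u²)`, `n = (u e_r - u'e_t)/√(u'² + u²)` ((2.46)–(2.47)), asserting
"`|k'₁| ≤ Cγ^h` and `|k'₂| ≤ Cγ^{h/2}` … see Lemma 7.3 of [BGM] for details" — [BGM] =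
Benfatto–Giuliani–Mastropietro 2003, whose §7.1 proves, for a smooth strictly convex polar curve,

* Lemma 7.2: if `k = ρ e_r(θ)` has `|ε(k) - μ| ≤ cγ^h` then `|ρ - u(θ)| ≤ c'γ^h` (the radial
  derivative of `ε` is bounded below, (2.8b));
* (A1.15)–(A1.16): `[p_F(θ₁) - p_F(θ₂)]·n(θ₂) = O((θ₁ - θ₂)²)`, `[p_F(θ₁) - p_F(θ₂)]·τ(θ₂) = O(θ₁ - θ₂)`;
* Lemma 7.3: hence the normal coordinate of a sector momentum is `O(γ^h)` and the tangential one
  `O(γ^{h/2})`.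

This file PROVES these statements for the Hubbard Fermi curve at BGM 2006's fillings, with
explicit `μ`-dependent constants:

* §1 uniform constants of the curve: `|u'| ≤ 4π³/(μ+4)`, `u² + u'² ≤ K(μ)`, the polar identity
  `x'y'' - y'x'' = u² + 2u'² - u u''` and **`|u''| ≤ A(μ)`**, bounds on `|x'|, |y'|, |x''|, |y''|`;
* §2 **Lemma 7.2** (`radial_deviation_le`): for `0 < ρ ≤ π/2`,
  `(4/π) · min(ρ, u(θ)) · |ρ - u(θ)| ≤ |ε(ρ e_r(θ)) - μ|` (monotone mean value theorem along the ray,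
  `∂_ρ ε(ρe_r) = (∇ε·k)/ρ ≥ (4/π)ρ` by Jordan's inequality);
* §3 **(A1.16)** (`abs_fermiX_sub_le`, `abs_fermiY_sub_le`): `|p_F(θ₁) - p_F(θ₂)| ≤ √K |θ₁ - θ₂|`
  componentwise, and **(A1.15)** (`abs_normal_deviation_le`):
  `|(x(θ₁) - x(θ₂)) y'(θ₂) - (y(θ₁) - y(θ₂)) x'(θ₂)| ≤ 2 A₂ √K (θ₁ - θ₂)²` (two mean value theorems
  on `g(θ) = (x(θ) - x(θ₂))y'(θ₂) - (y(θ) - y(θ₂))x'(θ₂)`, `g(θ₂) = g'(θ₂) = 0`, `|g''| ≤ 2A₂√K`);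
* §4 **Lemma 7.3 / BGM 2006 (2.46)–(2.47)** (`fermiTangent`, `fermiNormal`: the orthonormal moving
  frame; `sector_decomposition`: `k - p_F(θ₀) = k'₁ n(θ₀) + k'₂ τ(θ₀)` with
  `k'₁ = (k - p_F(θ₀))·n(θ₀)`, `k'₂ = (k - p_F(θ₀))·τ(θ₀)`; `abs_normalCoord_le`,
  `abs_tangentCoord_le`): for `k = ρ e_r(θ)`,
  `|k'₁| ≤ |ρ - u(θ)| + (2A₂√K/√(μ+4)) (θ - θ₀)²` and `|k'₂| ≤ |ρ - u(θ)| + √(2K) |θ - θ₀|` —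
  with `|ρ - u(θ)| ≤ Cγ^h` (Lemma 7.2 and (2.42a)) and `|θ - θ₀| ≤ (3π/4)γ^{h/2}` ((2.45)) these are
  the printed `|k'₁| ≤ Cγ^h`, `|k'₂| ≤ Cγ^{h/2}`.

Everything is PROVED; definitions with bodies only (`fermiTangent`, `fermiNormal`, the two
coordinates `normalCoord`, `tangentCoord`). [folklore] computations on the explicit dispersion.

## Sources

* G. Benfatto, A. Giuliani, V. Mastropietro, Ann. Henri Poincaré 4 (2003) 137–193, §7.1,
  Lemmas 7.2–7.3, (A1.10a)–(A1.16) (arXiv:cond-mat/0207210 p. 26). [BenfattoGiulianiMastropietro2003]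
* G. Benfatto, A. Giuliani, V. Mastropietro, Ann. Henri Poincaré 7 (2006) 809–898, §2.5
  (2.45)–(2.47) (arXiv:cond-mat/0507686 p. 10). [BenfattoGiulianiMastropietro2006]
-/

noncomputable section

open Real Set Filter
open scoped Topology

namespace Literature.MathematicalPhysics.QuantumLattice

section Range

variable {μ : ℝ} (hμ₁ : -4 < μ) (hμ₂ : μ < -2 - Real.sqrt 2)
include hμ₁ hμ₂

/-! ### §1 Uniform constants of the curve -/

/-- `|u'(θ)| ≤ 4π³/(μ+4)` uniformly in `θ`. [folklore] -/
theorem abs_fermiRadiusDeriv_le_const (θ : ℝ) : |fermiRadiusDeriv μ θ| ≤ 4 * π ^ 3 / (μ + 4) := by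
  have hμ4 : 0 < μ + 4 := by linarith
  have hu := fermiRadius_pos hμ₁ hμ₂ θ
  have hU2 := fermiRadius_sq_lt hμ₁ hμ₂ θ
  have hπ2 : π ^ 2 ≤ 4 ^ 2 := pow_le_pow_left₀ Real.pi_pos.le Real.pi_le_four 2
  have hu3 : fermiRadius μ θ ^ 3 ≤ 4 := by
    have hu1 : fermiRadius μ θ ^ 2 < 2 := by nlinarith
    have hul : fermiRadius μ θ < 2 := by nlinarith
    nlinarith
  refine (abs_fermiRadiusDeriv_le hμ₁ hμ₂ θ).trans ?_
  rw [div_le_div_iff_of_pos_right hμ4]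
  have : π ≤ π ^ 3 := by nlinarith [Real.two_le_pi]
  nlinarith [Real.pi_pos]

/-- `u² + u'² ≤ K(μ) := π²/8 + (4π³/(μ+4))²` uniformly in `θ`. [folklore] -/
theorem fermiSpeedSq_le (θ : ℝ) :
    fermiRadius μ θ ^ 2 + fermiRadiusDeriv μ θ ^ 2 ≤ π ^ 2 / 8 + (4 * π ^ 3 / (μ + 4)) ^ 2 := by
  have h1 : fermiRadiusDeriv μ θ ^ 2 ≤ (4 * π ^ 3 / (μ + 4)) ^ 2 := by
    rw [← sq_abs]; exact pow_le_pow_left₀ (abs_nonneg _) (abs_fermiRadiusDeriv_le_const hμ₁ hμ₂ θ) 2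
  linarith [fermiRadius_sq_lt hμ₁ hμ₂ θ]

omit hμ₁ hμ₂ in
/-- **The polar curvature numerator**: `x'y'' - y'x'' = u² + 2u'² - u u''`. [folklore] -/
theorem cross_eq_polar (μ θ : ℝ) :
    fermiVX μ θ * fermiAY μ θ - fermiVY μ θ * fermiAX μ θ =
      fermiRadius μ θ ^ 2 + 2 * fermiRadiusDeriv μ θ ^ 2 - fermiRadius μ θ * fermiRadiusDeriv2 μ θ := by
  have hsc := Real.sin_sq_add_cos_sq θ
  simp only [fermiVX, fermiVY, fermiAX, fermiAY]
  linear_combination (2 * fermiRadiusDeriv μ θ ^ 2 + fermiRadius μ θ ^ 2 -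
    fermiRadius μ θ * fermiRadiusDeriv2 μ θ) * hsc

/-- **`|u''(θ)| ≤ A(μ)` uniformly**: from `u u'' = u² + 2u'² - (x'y'' - y'x'')` and
`0 < x'y'' - y'x'' = Hess/c ≤ (u² + u'²)·π³/(16(μ+4))`. [folklore] -/
theorem abs_fermiRadiusDeriv2_le (θ : ℝ) :
    |fermiRadiusDeriv2 μ θ| ≤
      (2 + π ^ 3 / (16 * (μ + 4))) * (π ^ 2 / 8 + (4 * π ^ 3 / (μ + 4)) ^ 2) / Real.sqrt (μ + 4) := by
  have hμ4 : 0 < μ + 4 := by linarith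
  have hπ := Real.pi_pos
  have hu := fermiRadius_pos hμ₁ hμ₂ θ
  set K : ℝ := π ^ 2 / 8 + (4 * π ^ 3 / (μ + 4)) ^ 2 with hK
  set s2 := fermiRadius μ θ ^ 2 + fermiRadiusDeriv μ θ ^ 2 with hs2
  have hs2K : s2 ≤ K := fermiSpeedSq_le hμ₁ hμ₂ θ
  have hs2nn : 0 ≤ s2 := by positivity
  have hc := normalCoeff_pos hμ₁ hμ₂ θ
  have hcge := le_normalCoeff hμ₁ hμ₂ θ
  set cross := fermiVX μ θ * fermiAY μ θ - fermiVY μ θ * fermiAX μ θ with hcross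
  -- `0 < cross ≤ s2 / cmin`
  have hNc := normalCoeff_mul_cross hμ₁ hμ₂ θ
  have hNle := hess_fermi_le (μ := μ) θ
  have hNge := hess_fermi_ge hμ₁ hμ₂ θ
  have hcross_pos : 0 < cross := by
    have : 0 < normalCoeff μ θ * cross := by
      rw [hcross, hNc]; exact lt_of_lt_of_le (by positivity) hNge
    exact pos_of_mul_pos_right this hc.le
  have hcross_le : cross ≤ s2 * (π ^ 3 / (16 * (μ + 4))) := by
    -- `cmin * cross ≤ c * cross = N ≤ s2`
    have h1 : 16 * (μ + 4) / π ^ 3 * cross ≤ s2 := by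
      calc 16 * (μ + 4) / π ^ 3 * cross ≤ normalCoeff μ θ * cross :=
            mul_le_mul_of_nonneg_right hcge hcross_pos.le
        _ ≤ s2 := by rw [hcross, hNc]; exact hNle
    rw [div_mul_eq_mul_div, div_le_iff₀ (by positivity)] at h1
    rw [mul_div_assoc', le_div_iff₀ (by positivity)]
    linarith
  -- `u u'' = s2 + u'² - cross`
  have hpolar := cross_eq_polar μ θ
  have hsqrt : Real.sqrt (μ + 4) ≤ fermiRadius μ θ := sqrt_le_fermiRadius hμ₁ hμ₂ θ
  have hsqrt_pos : 0 < Real.sqrt (μ + 4) := Real.sqrt_pos.2 hμ4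
  -- reduce to `u |u''| ≤ (2 + 1/cmin) K`
  rw [le_div_iff₀ hsqrt_pos]
  have key : fermiRadius μ θ * |fermiRadiusDeriv2 μ θ| ≤ (2 + π ^ 3 / (16 * (μ + 4))) * K := by
    set q : ℝ := π ^ 3 / (16 * (μ + 4)) with hq
    have hq0 : 0 ≤ q := by positivity
    have hK0 : 0 ≤ K := hs2nn.trans hs2K
    have hqK : s2 * q ≤ K * q := mul_le_mul_of_nonneg_right hs2K hq0
    have hqK0 : 0 ≤ q * K := mul_nonneg hq0 hK0
    have hprod : fermiRadius μ θ * fermiRadiusDeriv2 μ θ = s2 + fermiRadiusDeriv μ θ ^ 2 - cross := by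
      rw [hs2, hcross, hpolar]; ring
    have hd2 : fermiRadiusDeriv μ θ ^ 2 ≤ s2 := by
      rw [hs2]; nlinarith [sq_nonneg (fermiRadius μ θ)]
    have hd0 : 0 ≤ fermiRadiusDeriv μ θ ^ 2 := sq_nonneg _
    rw [← abs_of_pos hu, ← abs_mul, abs_le, hprod]
    constructor
    · nlinarith
    · nlinarith
  calc |fermiRadiusDeriv2 μ θ| * Real.sqrt (μ + 4) ≤ |fermiRadiusDeriv2 μ θ| * fermiRadius μ θ :=
        mul_le_mul_of_nonneg_left hsqrt (abs_nonneg _)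
    _ = fermiRadius μ θ * |fermiRadiusDeriv2 μ θ| := mul_comm _ _
    _ ≤ (2 + π ^ 3 / (16 * (μ + 4))) * K := key

/-- `x'² ≤ u² + u'²`, so `|x'| ≤ √K`. [folklore] -/
theorem abs_fermiVX_le (θ : ℝ) :
    |fermiVX μ θ| ≤ Real.sqrt (π ^ 2 / 8 + (4 * π ^ 3 / (μ + 4)) ^ 2) := by
  refine Real.abs_le_sqrt ?_
  have := fermiVX_sq_add_fermiVY_sq μ θ
  nlinarith [fermiSpeedSq_le hμ₁ hμ₂ θ, sq_nonneg (fermiVY μ θ)]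

/-- `|y'| ≤ √K`. [folklore] -/
theorem abs_fermiVY_le (θ : ℝ) :
    |fermiVY μ θ| ≤ Real.sqrt (π ^ 2 / 8 + (4 * π ^ 3 / (μ + 4)) ^ 2) := by
  refine Real.abs_le_sqrt ?_
  have := fermiVX_sq_add_fermiVY_sq μ θ
  nlinarith [fermiSpeedSq_le hμ₁ hμ₂ θ, sq_nonneg (fermiVX μ θ)]

/-- The acceleration bound: `|x''|, |y''| ≤ A₂(μ) := A(μ) + 2·4π³/(μ+4) + 2`
(`|u''| + 2|u'| + |u|`, `u < 2`). [folklore] -/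
def accelBound (μ : ℝ) : ℝ :=
  (2 + π ^ 3 / (16 * (μ + 4))) * (π ^ 2 / 8 + (4 * π ^ 3 / (μ + 4)) ^ 2) / Real.sqrt (μ + 4) +
    2 * (4 * π ^ 3 / (μ + 4)) + 2

omit hμ₁ hμ₂ in
/-- Unfolding of `accelBound`. [folklore] -/
theorem accelBound_eq (μ : ℝ) : accelBound μ =
    (2 + π ^ 3 / (16 * (μ + 4))) * (π ^ 2 / 8 + (4 * π ^ 3 / (μ + 4)) ^ 2) / Real.sqrt (μ + 4) +
      2 * (4 * π ^ 3 / (μ + 4)) + 2 := rfl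

/-- `u < 2`. [folklore] -/
theorem fermiRadius_lt_two (θ : ℝ) : fermiRadius μ θ < 2 := by
  have hU2 := fermiRadius_sq_lt hμ₁ hμ₂ θ
  have hu := fermiRadius_pos hμ₁ hμ₂ θ
  have hπ2 : π ^ 2 ≤ 4 ^ 2 := pow_le_pow_left₀ Real.pi_pos.le Real.pi_le_four 2
  have hu1 : fermiRadius μ θ ^ 2 < 2 := by nlinarith
  nlinarith

/-- `|x''(θ)| ≤ A₂(μ)`. [folklore] -/
theorem abs_fermiAX_le (θ : ℝ) : |fermiAX μ θ| ≤ accelBound μ := by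
  have h2 := abs_fermiRadiusDeriv2_le hμ₁ hμ₂ θ
  have h1 := abs_fermiRadiusDeriv_le_const hμ₁ hμ₂ θ
  have h0 := fermiRadius_lt_two hμ₁ hμ₂ θ
  have hu := fermiRadius_pos hμ₁ hμ₂ θ
  have hc := Real.abs_cos_le_one θ
  have hs := Real.abs_sin_le_one θ
  have t1 : |fermiRadiusDeriv2 μ θ * Real.cos θ| ≤ |fermiRadiusDeriv2 μ θ| := by
    rw [abs_mul]; exact mul_le_of_le_one_right (abs_nonneg _) hc
  have t2 : |2 * fermiRadiusDeriv μ θ * Real.sin θ| ≤ 2 * |fermiRadiusDeriv μ θ| := by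
    rw [abs_mul, abs_mul, abs_of_pos (by norm_num : (0:ℝ) < 2)]
    exact mul_le_of_le_one_right (by positivity) hs
  have t3 : |fermiRadius μ θ * Real.cos θ| ≤ fermiRadius μ θ := by
    rw [abs_mul, abs_of_pos hu]; exact mul_le_of_le_one_right hu.le hc
  have tri : |fermiAX μ θ| ≤ |fermiRadiusDeriv2 μ θ * Real.cos θ| + |2 * fermiRadiusDeriv μ θ * Real.sin θ| +
      |fermiRadius μ θ * Real.cos θ| := by
    rw [fermiAX]
    exact (abs_sub _ _).trans (add_le_add (abs_sub _ _) le_rfl)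
  rw [accelBound]
  linarith

/-- `|y''(θ)| ≤ A₂(μ)`. [folklore] -/
theorem abs_fermiAY_le (θ : ℝ) : |fermiAY μ θ| ≤ accelBound μ := by
  have h2 := abs_fermiRadiusDeriv2_le hμ₁ hμ₂ θ
  have h1 := abs_fermiRadiusDeriv_le_const hμ₁ hμ₂ θ
  have h0 := fermiRadius_lt_two hμ₁ hμ₂ θ
  have hu := fermiRadius_pos hμ₁ hμ₂ θ
  have hc := Real.abs_cos_le_one θ
  have hs := Real.abs_sin_le_one θ
  have t1 : |fermiRadiusDeriv2 μ θ * Real.sin θ| ≤ |fermiRadiusDeriv2 μ θ| := by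
    rw [abs_mul]; exact mul_le_of_le_one_right (abs_nonneg _) hs
  have t2 : |2 * fermiRadiusDeriv μ θ * Real.cos θ| ≤ 2 * |fermiRadiusDeriv μ θ| := by
    rw [abs_mul, abs_mul, abs_of_pos (by norm_num : (0:ℝ) < 2)]
    exact mul_le_of_le_one_right (by positivity) hc
  have t3 : |fermiRadius μ θ * Real.sin θ| ≤ fermiRadius μ θ := by
    rw [abs_mul, abs_of_pos hu]; exact mul_le_of_le_one_right hu.le hs
  have tri : |fermiAY μ θ| ≤ |fermiRadiusDeriv2 μ θ * Real.sin θ| + |2 * fermiRadiusDeriv μ θ * Real.cos θ| +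
      |fermiRadius μ θ * Real.sin θ| := by
    rw [fermiAY]
    exact (abs_sub _ _).trans (add_le_add (abs_add_le _ _) le_rfl)
  rw [accelBound]
  linarith

/-! ### §2 Lemma 7.2: the radial deviation is controlled by the energy deviation -/

omit hμ₁ hμ₂ in
/-- Along a ray the dispersion has radial derivative `∂_ρ ε(ρ e_r) = (∇ε·k)/ρ ≥ (4/π) ρ` for
`0 < ρ ≤ π/2` (Jordan's inequality, `div_mul_sq_le_radialDeriv`). [folklore] -/
theorem le_rayDispersionDt {θ t : ℝ} (ht0 : 0 < t) (ht : t ≤ π / 2) : 4 / π * t ≤ rayDispersionDt θ t := by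
  have hk : ∀ i, |(t • dir θ) i| ≤ π / 2 := fun i => by
    rw [Pi.smul_apply, smul_eq_mul, abs_mul, abs_of_pos ht0]
    calc t * |dir θ i| ≤ t * 1 := mul_le_mul_of_nonneg_left (abs_dir_le_one θ i) ht0.le
      _ ≤ π / 2 := by linarith
  have h := div_mul_sq_le_radialDeriv hk
  rw [← mul_rayDispersionDt] at h
  have hsc := Real.sin_sq_add_cos_sq θ
  have hsq : (t • dir θ) 0 ^ 2 + (t • dir θ) 1 ^ 2 = t ^ 2 := by
    simp only [Pi.smul_apply, smul_eq_mul, dir, Matrix.cons_val_zero, Matrix.cons_val_one]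
    nlinarith [hsc]
  rw [hsq] at h
  -- `4/π t² ≤ t · D` with `t > 0`
  have : 4 / π * t * t ≤ rayDispersionDt θ t * t := by nlinarith [h]
  exact le_of_mul_le_mul_right this ht0

/-- **Lemma 7.2 of BGM 2003 for the Hubbard curve**: for `0 < ρ ≤ π/2`,
`(4/π) · min(ρ, u(θ)) · |ρ - u(θ)| ≤ |ε(ρ e_r(θ)) - μ|`; hence a momentum `ρ e_r(θ)` of the shell
`|ε - μ| ≤ cγ^h` lies within `O(γ^h)` of the Fermi curve along its ray. (Monotone mean value
theorem for `ρ ↦ ε(ρ e_r)` between `ρ` and `u(θ)`.) [cite: BenfattoGiulianiMastropietro2003, §7.1 Lemma 7.2] -/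
theorem radial_deviation_le (θ : ℝ) {ρ : ℝ} (hρ0 : 0 < ρ) (hρ : ρ ≤ π / 2) :
    4 / π * min ρ (fermiRadius μ θ) * |ρ - fermiRadius μ θ| ≤
      |sqDispersion (ρ • dir θ) - μ| := by
  set u := fermiRadius μ θ with hu_def
  have hu : 0 < u := fermiRadius_pos hμ₁ hμ₂ θ
  have hule : u ≤ π / 2 := fermiRadius_le hμ₁ hμ₂ θ
  have hεu : sqDispersion (u • dir θ) = μ := sqDispersion_fermiRadius hμ₁ hμ₂ θ
  -- the monotone mean value theorem on `[a, b]`, `a = min ρ u`, `b = max ρ u`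
  set a := min ρ u with ha
  set b := max ρ u with hb
  have ha0 : 0 < a := lt_min hρ0 hu
  have hbπ : b ≤ π / 2 := max_le hρ hule
  have hf : ∀ t, HasDerivAt (fun s => rayDispersion (θ, s)) (rayDispersionDt θ t) t :=
    hasDerivAt_rayDispersion_radius θ
  have hcont : ContinuousOn (fun s => rayDispersion (θ, s)) (Icc a b) :=
    fun t _ => (hf t).continuousAt.continuousWithinAt
  have hdiff : DifferentiableOn ℝ (fun s => rayDispersion (θ, s)) (interior (Icc a b)) :=
    fun t _ => (hf t).differentiableAt.differentiableWithinAt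
  have hge : ∀ t ∈ interior (Icc a b), 4 / π * a ≤ deriv (fun s => rayDispersion (θ, s)) t := by
    intro t ht
    rw [interior_Icc] at ht
    rw [(hf t).deriv]
    have ht0 : 0 < t := ha0.trans ht.1
    have htπ : t ≤ π / 2 := ht.2.le.trans hbπ
    have h1 := le_rayDispersionDt (θ := θ) ht0 htπ
    have h2 : 4 / π * a ≤ 4 / π * t := mul_le_mul_of_nonneg_left ht.1.le (by positivity)
    linarith
  have hab : a ≤ b := min_le_max
  have hmvt := (convex_Icc a b).mul_sub_le_image_sub_of_le_deriv hcont hdiff hge a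
    (left_mem_Icc.2 hab) b (right_mem_Icc.2 hab) hab
  have hF : ∀ s : ℝ, rayDispersion (θ, s) = sqDispersion (s • dir θ) := fun s => rfl
  rw [hF, hF] at hmvt
  have hmin0 : 0 ≤ 4 / π * a := by positivity
  rcases le_total ρ u with h | h
  · have ha' : a = ρ := min_eq_left h
    have hb' : b = u := max_eq_right h
    rw [ha', hb', hεu] at hmvt
    have hnn : 0 ≤ 4 / π * ρ * (u - ρ) := mul_nonneg (by positivity) (sub_nonneg.2 h)
    rw [ha', abs_of_nonpos (sub_nonpos.2 h), abs_of_nonpos (by linarith)]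
    nlinarith [hmvt]
  · have ha' : a = u := min_eq_right h
    have hb' : b = ρ := max_eq_left h
    rw [ha', hb', hεu] at hmvt
    have hnn : 0 ≤ 4 / π * u * (ρ - u) := mul_nonneg (by positivity) (sub_nonneg.2 h)
    rw [ha', abs_of_nonneg (sub_nonneg.2 h), abs_of_nonneg (by linarith)]
    nlinarith [hmvt]

/-! ### §3 (A1.15)–(A1.16): normal and tangential deviations along the curve -/

/-- **(A1.16), first component**: `|x(θ₁) - x(θ₂)| ≤ √K |θ₁ - θ₂|` (mean value theorem,
`|x'| ≤ √K`). [cite: BenfattoGiulianiMastropietro2003, §7.1 (A1.16)] -/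
theorem abs_fermiX_sub_le (θ₁ θ₂ : ℝ) :
    |fermiX μ θ₁ - fermiX μ θ₂| ≤ Real.sqrt (π ^ 2 / 8 + (4 * π ^ 3 / (μ + 4)) ^ 2) * |θ₁ - θ₂| := by
  have h := (convex_univ (𝕜 := ℝ) (E := ℝ)).norm_image_sub_le_of_norm_hasDerivWithin_le
    (f := fermiX μ) (f' := fermiVX μ) (fun t _ => (hasDerivAt_fermiX hμ₁ hμ₂ t).hasDerivWithinAt)
    (fun t _ => by rw [Real.norm_eq_abs]; exact abs_fermiVX_le hμ₁ hμ₂ t) (mem_univ θ₂) (mem_univ θ₁)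
  rwa [Real.norm_eq_abs, Real.norm_eq_abs] at h

/-- **(A1.16), second component**: `|y(θ₁) - y(θ₂)| ≤ √K |θ₁ - θ₂|`. [cite: BenfattoGiulianiMastropietro2003, §7.1 (A1.16)] -/
theorem abs_fermiY_sub_le (θ₁ θ₂ : ℝ) :
    |fermiY μ θ₁ - fermiY μ θ₂| ≤ Real.sqrt (π ^ 2 / 8 + (4 * π ^ 3 / (μ + 4)) ^ 2) * |θ₁ - θ₂| := by
  have h := (convex_univ (𝕜 := ℝ) (E := ℝ)).norm_image_sub_le_of_norm_hasDerivWithin_le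
    (f := fermiY μ) (f' := fermiVY μ) (fun t _ => (hasDerivAt_fermiY hμ₁ hμ₂ t).hasDerivWithinAt)
    (fun t _ => by rw [Real.norm_eq_abs]; exact abs_fermiVY_le hμ₁ hμ₂ t) (mem_univ θ₂) (mem_univ θ₁)
  rwa [Real.norm_eq_abs, Real.norm_eq_abs] at h

/-- **(A1.15): the normal deviation is quadratic**:
`|(x(θ₁) - x(θ₂)) y'(θ₂) - (y(θ₁) - y(θ₂)) x'(θ₂)| ≤ 2 A₂ √K (θ₁ - θ₂)²` — i.e.
`[p_F(θ₁) - p_F(θ₂)]·n(θ₂) = O((θ₁ - θ₂)²)` after dividing by `|p'(θ₂)| ≥ √(μ+4)`. Two mean value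
theorems: `g(θ) = (x(θ) - x(θ₂))y'(θ₂) - (y(θ) - y(θ₂))x'(θ₂)` has `g(θ₂) = g'(θ₂) = 0` and
`|g''| ≤ 2A₂√K`. [cite: BenfattoGiulianiMastropietro2003, §7.1 (A1.15)] -/
theorem abs_normal_deviation_le (θ₁ θ₂ : ℝ) :
    |(fermiX μ θ₁ - fermiX μ θ₂) * fermiVY μ θ₂ - (fermiY μ θ₁ - fermiY μ θ₂) * fermiVX μ θ₂| ≤
      2 * accelBound μ * Real.sqrt (π ^ 2 / 8 + (4 * π ^ 3 / (μ + 4)) ^ 2) * (θ₁ - θ₂) ^ 2 := by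
  set RK := Real.sqrt (π ^ 2 / 8 + (4 * π ^ 3 / (μ + 4)) ^ 2) with hRK
  set M := 2 * accelBound μ * RK with hM
  -- the functions `g` and `g₁ = g'`
  set g : ℝ → ℝ := fun θ => (fermiX μ θ - fermiX μ θ₂) * fermiVY μ θ₂ -
    (fermiY μ θ - fermiY μ θ₂) * fermiVX μ θ₂ with hg
  set g₁ : ℝ → ℝ := fun θ => fermiVX μ θ * fermiVY μ θ₂ - fermiVY μ θ * fermiVX μ θ₂ with hg₁
  have hg' : ∀ θ, HasDerivAt g (g₁ θ) θ := by
    intro θ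
    have h := (((hasDerivAt_fermiX hμ₁ hμ₂ θ).sub_const (fermiX μ θ₂)).mul_const (fermiVY μ θ₂)).sub
      (((hasDerivAt_fermiY hμ₁ hμ₂ θ).sub_const (fermiY μ θ₂)).mul_const (fermiVX μ θ₂))
    exact h
  have hg₁' : ∀ θ, HasDerivAt g₁ (fermiAX μ θ * fermiVY μ θ₂ - fermiAY μ θ * fermiVX μ θ₂) θ := by
    intro θ
    exact ((hasDerivAt_fermiVX hμ₁ hμ₂ θ).mul_const _).sub ((hasDerivAt_fermiVY hμ₁ hμ₂ θ).mul_const _)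
  -- `|g₁'| ≤ M`
  have hRK0 : 0 ≤ RK := Real.sqrt_nonneg _
  have hA0 : 0 ≤ accelBound μ := (abs_nonneg _).trans (abs_fermiAX_le hμ₁ hμ₂ 0)
  have hbound₁ : ∀ θ, |fermiAX μ θ * fermiVY μ θ₂ - fermiAY μ θ * fermiVX μ θ₂| ≤ M := by
    intro θ
    have h1 : |fermiAX μ θ * fermiVY μ θ₂| ≤ accelBound μ * RK := by
      rw [abs_mul]; exact mul_le_mul (abs_fermiAX_le hμ₁ hμ₂ θ) (abs_fermiVY_le hμ₁ hμ₂ θ₂) (abs_nonneg _) hA0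
    have h2 : |fermiAY μ θ * fermiVX μ θ₂| ≤ accelBound μ * RK := by
      rw [abs_mul]; exact mul_le_mul (abs_fermiAY_le hμ₁ hμ₂ θ) (abs_fermiVX_le hμ₁ hμ₂ θ₂) (abs_nonneg _) hA0
    calc _ ≤ |fermiAX μ θ * fermiVY μ θ₂| + |fermiAY μ θ * fermiVX μ θ₂| := abs_sub _ _
      _ ≤ M := by rw [hM]; linarith
  -- first mean value theorem: `|g₁ θ| ≤ M |θ - θ₂|` (note `g₁ θ₂ = 0`)
  have hg₁0 : g₁ θ₂ = 0 := by simp only [hg₁]; ring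
  have hstep1 : ∀ θ, |g₁ θ| ≤ M * |θ - θ₂| := by
    intro θ
    have h := (convex_univ (𝕜 := ℝ) (E := ℝ)).norm_image_sub_le_of_norm_hasDerivWithin_le
      (f := g₁) (fun t _ => (hg₁' t).hasDerivWithinAt)
      (fun t _ => by rw [Real.norm_eq_abs]; exact hbound₁ t) (mem_univ θ₂) (mem_univ θ)
    rwa [hg₁0, sub_zero, Real.norm_eq_abs, Real.norm_eq_abs] at h
  -- second mean value theorem on the segment, where `|g'| ≤ M |θ₁ - θ₂|`
  have hg0 : g θ₂ = 0 := by simp only [hg]; ring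
  have hM0 : 0 ≤ M := by rw [hM]; positivity
  have h := (convex_uIcc θ₂ θ₁).norm_image_sub_le_of_norm_hasDerivWithin_le (f := g)
    (C := M * |θ₁ - θ₂|) (fun t _ => (hg' t).hasDerivWithinAt)
    (fun t ht => by
      rw [Real.norm_eq_abs]
      exact (hstep1 t).trans (mul_le_mul_of_nonneg_left (abs_sub_left_of_mem_uIcc ht) hM0))
    left_mem_uIcc right_mem_uIcc
  rw [hg0, sub_zero, Real.norm_eq_abs, Real.norm_eq_abs] at h
  calc |g θ₁| ≤ M * |θ₁ - θ₂| * |θ₁ - θ₂| := h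
    _ = M * (θ₁ - θ₂) ^ 2 := by rw [mul_assoc, ← sq, sq_abs]

/-! ### §4 Lemma 7.3 / BGM 2006 (2.46)–(2.47): the moving frame and the sector coordinates -/

omit hμ₁ hμ₂ in
/-- `s'(θ) = |p'(θ)| = √(u² + u'²)`. [cite: BenfattoGiulianiMastropietro2006, §2.5 (2.47)] -/
def fermiSpeed (μ θ : ℝ) : ℝ := Real.sqrt (fermiRadius μ θ ^ 2 + fermiRadiusDeriv μ θ ^ 2)

/-- `s' > 0`. [folklore] -/
theorem fermiSpeed_pos (θ : ℝ) : 0 < fermiSpeed μ θ :=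
  Real.sqrt_pos.2 (by have := fermiRadius_pos hμ₁ hμ₂ θ; positivity)

omit hμ₁ hμ₂ in
/-- `s'² = u² + u'² = x'² + y'²`. [folklore] -/
theorem fermiSpeed_sq (μ θ : ℝ) : fermiSpeed μ θ ^ 2 = fermiVX μ θ ^ 2 + fermiVY μ θ ^ 2 := by
  rw [fermiSpeed, Real.sq_sqrt (by positivity), fermiVX_sq_add_fermiVY_sq]

/-- `√(μ+4) ≤ s'` (`s' ≥ u`). [folklore] -/
theorem sqrt_le_fermiSpeed (θ : ℝ) : Real.sqrt (μ + 4) ≤ fermiSpeed μ θ := by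
  refine Real.sqrt_le_sqrt ?_
  nlinarith [add_four_le_fermiRadius_sq hμ₁ hμ₂ θ, sq_nonneg (fermiRadiusDeriv μ θ)]

omit hμ₁ hμ₂ in
/-- **The unit tangent** `τ(θ) = p'/|p'| = (u'e_r + u e_t)/√(u'² + u²)` of BGM 2006 (2.47), in
Cartesian components `(x', y')/s'`. [cite: BenfattoGiulianiMastropietro2006, §2.5 (2.47)] -/
def fermiTangent (μ θ : ℝ) : Fin 2 → ℝ := (fermiSpeed μ θ)⁻¹ • ![fermiVX μ θ, fermiVY μ θ]

omit hμ₁ hμ₂ in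
/-- **The outgoing unit normal** `n(θ) = (u e_r - u'e_t)/√(u'² + u²)` of BGM 2006 (2.47), in
Cartesian components `(y', -x')/s'`. [cite: BenfattoGiulianiMastropietro2006, §2.5 (2.47)] -/
def fermiNormal (μ θ : ℝ) : Fin 2 → ℝ := (fermiSpeed μ θ)⁻¹ • ![fermiVY μ θ, -fermiVX μ θ]

/-- Orthonormality: `|τ|² = 1`. [folklore] -/
theorem fermiTangent_normSq (θ : ℝ) : fermiTangent μ θ 0 ^ 2 + fermiTangent μ θ 1 ^ 2 = 1 := by
  have hs := fermiSpeed_pos hμ₁ hμ₂ θ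
  have hsq := fermiSpeed_sq μ θ
  simp only [fermiTangent, Pi.smul_apply, smul_eq_mul, Matrix.cons_val_zero, Matrix.cons_val_one]
  field_simp
  linarith

/-- Orthonormality: `|n|² = 1`. [folklore] -/
theorem fermiNormal_normSq (θ : ℝ) : fermiNormal μ θ 0 ^ 2 + fermiNormal μ θ 1 ^ 2 = 1 := by
  have hs := fermiSpeed_pos hμ₁ hμ₂ θ
  have hsq := fermiSpeed_sq μ θ
  simp only [fermiNormal, Pi.smul_apply, smul_eq_mul, Matrix.cons_val_zero, Matrix.cons_val_one]
  field_simp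
  linarith

omit hμ₁ hμ₂ in
/-- Orthonormality: `τ·n = 0`. [folklore] -/
theorem fermiTangent_dot_fermiNormal (μ θ : ℝ) :
    fermiTangent μ θ 0 * fermiNormal μ θ 0 + fermiTangent μ θ 1 * fermiNormal μ θ 1 = 0 := by
  simp only [fermiTangent, fermiNormal, Pi.smul_apply, smul_eq_mul, Matrix.cons_val_zero, Matrix.cons_val_one]
  ring

omit hμ₁ hμ₂ in
/-- The normal coordinate `k'₁ = (k - p_F(θ₀))·n(θ₀)` of a momentum `k` in the frame at `θ₀`
(BGM 2006 (2.46)). [cite: BenfattoGiulianiMastropietro2006, §2.5 (2.46)] -/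
def normalCoord (μ θ₀ : ℝ) (k : Fin 2 → ℝ) : ℝ :=
  (k 0 - fermiX μ θ₀) * fermiNormal μ θ₀ 0 + (k 1 - fermiY μ θ₀) * fermiNormal μ θ₀ 1

omit hμ₁ hμ₂ in
/-- The tangential coordinate `k'₂ = (k - p_F(θ₀))·τ(θ₀)` (BGM 2006 (2.46)). [cite: BenfattoGiulianiMastropietro2006, §2.5 (2.46)] -/
def tangentCoord (μ θ₀ : ℝ) (k : Fin 2 → ℝ) : ℝ :=
  (k 0 - fermiX μ θ₀) * fermiTangent μ θ₀ 0 + (k 1 - fermiY μ θ₀) * fermiTangent μ θ₀ 1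

/-- **The sector decomposition (2.46)**: every `k ∈ ℝ²` is
`k = p_F(θ₀) + k'₁ n(θ₀) + k'₂ τ(θ₀)` with the coordinates above (expansion in the orthonormal
frame). [cite: BenfattoGiulianiMastropietro2006, §2.5 (2.46)] -/
theorem sector_decomposition (θ₀ : ℝ) (k : Fin 2 → ℝ) :
    k = fermiRadius μ θ₀ • dir θ₀ + normalCoord μ θ₀ k • fermiNormal μ θ₀ +
      tangentCoord μ θ₀ k • fermiTangent μ θ₀ := by
  have hs := fermiSpeed_pos hμ₁ hμ₂ θ₀
  have hsq := fermiSpeed_sq μ θ₀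
  have hs2 : fermiSpeed μ θ₀ ^ 2 ≠ 0 := by positivity
  rw [fermiRadius_smul_dir_eq]
  ext i
  fin_cases i
  · simp only [normalCoord, tangentCoord, fermiNormal, fermiTangent, Pi.add_apply, Pi.smul_apply,
      smul_eq_mul, Matrix.cons_val_zero, Matrix.cons_val_one, Fin.zero_eta, Fin.isValue]
    field_simp
    linear_combination (k 0 - fermiX μ θ₀) * hsq
  · simp only [normalCoord, tangentCoord, fermiNormal, fermiTangent, Pi.add_apply, Pi.smul_apply,
      smul_eq_mul, Matrix.cons_val_zero, Matrix.cons_val_one, Fin.mk_one, Fin.isValue]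
    field_simp
    linear_combination (k 1 - fermiY μ θ₀) * hsq

omit hμ₁ hμ₂ in
/-- A unit vector has components of a dot product bounded by `1`: `|d·n| ≤ 1` for `|d| = |n| = 1`
(Cauchy–Schwarz in the plane). [folklore] -/
theorem abs_dot_le_one_of_unit {d₀ d₁ n₀ n₁ : ℝ} (hd : d₀ ^ 2 + d₁ ^ 2 = 1) (hn : n₀ ^ 2 + n₁ ^ 2 = 1) :
    |d₀ * n₀ + d₁ * n₁| ≤ 1 := by
  rw [abs_le]
  constructor <;> nlinarith [sq_nonneg (d₀ * n₁ - d₁ * n₀), sq_nonneg (d₀ + n₀), sq_nonneg (d₁ + n₁),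
    sq_nonneg (d₀ - n₀), sq_nonneg (d₁ - n₁)]

/-- **Lemma 7.3, normal coordinate** (BGM 2006: "`|k'₁| ≤ Cγ^h`"): for `k = ρ e_r(θ)`,
`|k'₁| ≤ |ρ - u(θ)| + (2A₂√K/√(μ+4)) (θ - θ₀)²` — the radial deviation (Lemma 7.2: `O(γ^h)` in a
shell) plus the quadratic normal deviation (A1.15) (`O(γ^h)` for `|θ - θ₀| = O(γ^{h/2})`). [cite: BenfattoGiulianiMastropietro2003, §7.1 Lemma 7.3] -/
theorem abs_normalCoord_le (θ₀ θ ρ : ℝ) :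
    |normalCoord μ θ₀ (ρ • dir θ)| ≤
      |ρ - fermiRadius μ θ| +
        2 * accelBound μ * Real.sqrt (π ^ 2 / 8 + (4 * π ^ 3 / (μ + 4)) ^ 2) / Real.sqrt (μ + 4) *
          (θ - θ₀) ^ 2 := by
  have hs := fermiSpeed_pos hμ₁ hμ₂ θ₀
  have hsge := sqrt_le_fermiSpeed hμ₁ hμ₂ θ₀
  have hμ4 : 0 < μ + 4 := by linarith
  have hsqrt : 0 < Real.sqrt (μ + 4) := Real.sqrt_pos.2 hμ4
  -- split `k - p₀ = (ρ - u θ) dir θ + (p θ - p₀)`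
  have hsplit : normalCoord μ θ₀ (ρ • dir θ) =
      (ρ - fermiRadius μ θ) * (dir θ 0 * fermiNormal μ θ₀ 0 + dir θ 1 * fermiNormal μ θ₀ 1) +
        ((fermiX μ θ - fermiX μ θ₀) * fermiVY μ θ₀ - (fermiY μ θ - fermiY μ θ₀) * fermiVX μ θ₀) *
          (fermiSpeed μ θ₀)⁻¹ := by
    simp only [normalCoord, fermiNormal, Pi.smul_apply, smul_eq_mul, Matrix.cons_val_zero,
      Matrix.cons_val_one, fermiX, fermiY, dir]
    ring
  rw [hsplit]
  refine (abs_add_le _ _).trans (add_le_add ?_ ?_)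
  · rw [abs_mul]
    refine mul_le_of_le_one_right (abs_nonneg _) (abs_dot_le_one_of_unit ?_ (fermiNormal_normSq hμ₁ hμ₂ θ₀))
    simp [dir, Real.cos_sq_add_sin_sq]
  · rw [abs_mul, abs_inv, abs_of_pos hs, ← div_eq_mul_inv, div_le_iff₀ hs]
    refine (abs_normal_deviation_le hμ₁ hμ₂ θ θ₀).trans ?_
    rw [div_mul_eq_mul_div, mul_comm _ (fermiSpeed μ θ₀), ← mul_div_assoc, le_div_iff₀ hsqrt]
    have hq : 0 ≤ 2 * accelBound μ * Real.sqrt (π ^ 2 / 8 + (4 * π ^ 3 / (μ + 4)) ^ 2) * (θ - θ₀) ^ 2 := by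
      have hA0 : 0 ≤ accelBound μ := (abs_nonneg _).trans (abs_fermiAX_le hμ₁ hμ₂ 0)
      positivity
    calc 2 * accelBound μ * Real.sqrt (π ^ 2 / 8 + (4 * π ^ 3 / (μ + 4)) ^ 2) * (θ - θ₀) ^ 2 * Real.sqrt (μ + 4)
        ≤ 2 * accelBound μ * Real.sqrt (π ^ 2 / 8 + (4 * π ^ 3 / (μ + 4)) ^ 2) * (θ - θ₀) ^ 2 * fermiSpeed μ θ₀ :=
          mul_le_mul_of_nonneg_left hsge hq
      _ = fermiSpeed μ θ₀ * (2 * accelBound μ * Real.sqrt (π ^ 2 / 8 + (4 * π ^ 3 / (μ + 4)) ^ 2) * (θ - θ₀) ^ 2) := by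
          ring

/-- **Lemma 7.3, tangential coordinate** (BGM 2006: "`|k'₂| ≤ Cγ^{h/2}`"): for `k = ρ e_r(θ)`,
`|k'₂| ≤ |ρ - u(θ)| + 2√K |θ - θ₀|` (radial deviation plus the Lipschitz bound (A1.16)). [cite: BenfattoGiulianiMastropietro2003, §7.1 Lemma 7.3] -/
theorem abs_tangentCoord_le (θ₀ θ ρ : ℝ) :
    |tangentCoord μ θ₀ (ρ • dir θ)| ≤
      |ρ - fermiRadius μ θ| + 2 * Real.sqrt (π ^ 2 / 8 + (4 * π ^ 3 / (μ + 4)) ^ 2) * |θ - θ₀| := by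
  have hs := fermiSpeed_pos hμ₁ hμ₂ θ₀
  set RK := Real.sqrt (π ^ 2 / 8 + (4 * π ^ 3 / (μ + 4)) ^ 2) with hRK
  have hsplit : tangentCoord μ θ₀ (ρ • dir θ) =
      (ρ - fermiRadius μ θ) * (dir θ 0 * fermiTangent μ θ₀ 0 + dir θ 1 * fermiTangent μ θ₀ 1) +
        ((fermiX μ θ - fermiX μ θ₀) * fermiTangent μ θ₀ 0 + (fermiY μ θ - fermiY μ θ₀) * fermiTangent μ θ₀ 1) := by
    simp only [tangentCoord, Pi.smul_apply, smul_eq_mul, fermiX, fermiY, dir, Matrix.cons_val_zero,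
      Matrix.cons_val_one]
    ring
  rw [hsplit]
  refine (abs_add_le _ _).trans (add_le_add ?_ ?_)
  · rw [abs_mul]
    refine mul_le_of_le_one_right (abs_nonneg _) (abs_dot_le_one_of_unit ?_ (fermiTangent_normSq hμ₁ hμ₂ θ₀))
    simp [dir, Real.cos_sq_add_sin_sq]
  · -- `|τᵢ| ≤ 1`, `|x θ - x θ₀|, |y θ - y θ₀| ≤ √K |θ - θ₀|`
    have hτ := fermiTangent_normSq hμ₁ hμ₂ θ₀
    have hτ0 : |fermiTangent μ θ₀ 0| ≤ 1 := by
      rw [← Real.sqrt_one]; exact Real.abs_le_sqrt (by nlinarith [sq_nonneg (fermiTangent μ θ₀ 1)])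
    have hτ1 : |fermiTangent μ θ₀ 1| ≤ 1 := by
      rw [← Real.sqrt_one]; exact Real.abs_le_sqrt (by nlinarith [sq_nonneg (fermiTangent μ θ₀ 0)])
    have hx := abs_fermiX_sub_le hμ₁ hμ₂ θ θ₀
    have hy := abs_fermiY_sub_le hμ₁ hμ₂ θ θ₀
    calc |(fermiX μ θ - fermiX μ θ₀) * fermiTangent μ θ₀ 0 + (fermiY μ θ - fermiY μ θ₀) * fermiTangent μ θ₀ 1|
        ≤ |(fermiX μ θ - fermiX μ θ₀) * fermiTangent μ θ₀ 0| + |(fermiY μ θ - fermiY μ θ₀) * fermiTangent μ θ₀ 1| :=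
          abs_add_le _ _
      _ ≤ |fermiX μ θ - fermiX μ θ₀| + |fermiY μ θ - fermiY μ θ₀| := by
          rw [abs_mul, abs_mul]
          exact add_le_add (mul_le_of_le_one_right (abs_nonneg _) hτ0) (mul_le_of_le_one_right (abs_nonneg _) hτ1)
      _ ≤ RK * |θ - θ₀| + RK * |θ - θ₀| := add_le_add hx hy
      _ = 2 * RK * |θ - θ₀| := by ring

end Range

end Literature.MathematicalPhysics.QuantumLattice

end
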